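import Summits.CriticalPhenomena.PercolationContinuityZ3.Theorems.PercNearOneGluingNoHeavyLowerTailQuantitativeS5ZeroSet
import HarnessLib

/-!
# In the regime of the AdditiveGluing socket the (S5) margin vanishes iff `T = {b}`

Support file (`--supports stmt-CriticalPhenomena-4575`), prover seat `prim-rate-mine-2` (lane prim-rate, constants-miner (c), BENCH rows
M2-R24 / M2-R28; `run/shared/lean/prim/prim-rate/prim-rate-mine-2/PROOFS.md` §P28).  No definitions, no named facts, no sorries; standard axioms.

The cone's socket `CSH.additiveGluing_of_s5dMargin_nondegenerate` consumes `0 ≤ CSH.s5dMargin p T r [] o v F` for weight functions `p` that are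
NON-DEGENERATE ON EVERY PAIR (`0 < p e < 1` for all `e : Sym2 (Fin n)`), observers `o ≠ v` off `T`, an injective `m`-compatible rank, and — through the
induction `AGloc.gen_firstRank_of_surplusTransfer`, which keeps `F` fixed — the connection functional `F = 1{b ∈ ·}` of the gluing target `b`.  In that
regime the support graph is the complete graph: every pocket vertex is adjacent to every relay, so geometry (M1) of the zero set never occurs and (M2) forces
`T = {a}` with `b = a`.  Hence, by `CSH.s5dMargin_nil_eq_zero_iff`:
* `CSH.s5dMargin_nil_eq_zero_iff_eq_singleton_of_nondegenerate` — **`s5dMargin p T r [] o v 1{b ∈ ·} = 0 ⟺ T = {b}`** (`T ≠ ∅`);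
* `CSH.s5dMargin_nil_pos_of_nondegenerate_of_ne_singleton` — the margin is STRICTLY positive whenever `T ≠ {b}`.
So the surplus-transfer inequality (S5) is strict at every instance the socket uses except the trivial labelling in which the only relay is the target
itself (there `Sur_o({b}) = μ(o ↔ b)·(1 − m_b) = 0`). [cite: KozmaNitzan2024, Conj. 4 (p. 32)] [cite: Grimmett1999, §2.2]
-/

noncomputable section

namespace Summit.CriticalPhenomena.PercolationContinuityZ3.Theorems

open MeasureTheory Set Literature.Probability.LatticeModels Literature.Probability.Percolation
open scoped Classical

namespace CSH

variable {n : ℕ}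

/-- **Zero set of the (S5) margin in the socket's regime: `margin = 0 ⟺ T = {b}`.**  Weights `0 < p e < 1` on EVERY pair; `T ≠ ∅`; `r` injective on `T`
and compatible with the means of `1{b ∈ ·}`; `o ≠ v`, `o, v ∉ T`.  (⟹: by `CSH.s5dMargin_nil_eq_zero_iff` on the complete support, (M1) fails — a relay is
adjacent to `o` — and (M2) forces every relay to be the gateway `a` and `b = a`; ⟸: (M2) with `a = b`.) [cite: KozmaNitzan2024, Conj. 4 (p. 32)] -/
theorem s5dMargin_nil_eq_zero_iff_eq_singleton_of_nondegenerate (p : Sym2 (Fin n) → unitInterval) (hp : ∀ e, 0 < p e ∧ p e < 1)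
    (o v b : Fin n) (hov : o ≠ v) (T : Finset (Fin n)) (hT : T.Nonempty) (r : Fin n → ℕ) (hr : Set.InjOn r ↑T)
    (hcompat : ∀ a ∈ T, ∀ a' ∈ T, r a < r a' →
      ∫ ω, (fun S : Set (Fin n) => if b ∈ S then (1 : ℝ) else 0) (openCluster ω a) ∂(prodBernoulli p) ≤
        ∫ ω, (fun S : Set (Fin n) => if b ∈ S then (1 : ℝ) else 0) (openCluster ω a') ∂(prodBernoulli p))
    (hoT : o ∉ T) (hvT : v ∉ T) :
    s5dMargin p T r [] o v (fun S : Set (Fin n) => if b ∈ S then (1 : ℝ) else 0) = 0 ↔ T = {b} := by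
  set E : Set (Sym2 (Fin n)) := Set.univ with hE
  have hE0 : ∀ f, f ∉ E → (p f : ℝ) = 0 := fun f hf => absurd (Set.mem_univ f) hf
  have hE1 : ∀ f ∈ E, 0 < (p f : ℝ) ∧ (p f : ℝ) < 1 :=
    fun f _ => ⟨unitInterval.coe_pos.2 (hp f).1, unitInterval.coe_lt_one.2 (hp f).2⟩
  have hconn : (openGraph E).Preconnected := by
    intro x y
    by_cases hxy : x = y
    · rw [hxy]
    · have hadj : (openGraph E).Adj x y := by
        rw [openGraph, SimpleGraph.fromEdgeSet_adj]; exact ⟨Set.mem_univ _, hxy⟩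
      exact hadj.reachable
  set E0 : Set (Sym2 (Fin n)) := {f | f ∈ E ∧ ∀ z ∈ f, z ∉ T ∧ z ≠ v} with hE0def
  set ET : Set (Sym2 (Fin n)) := {f | f ∈ E ∧ ∀ z ∈ f, z ∉ T} with hETdef
  have hKout : ∀ y, (openGraph E0).Reachable o y → y ∉ T ∧ y ≠ v := fun y hy =>
    forall_reachable_of_edges (fun y => y ∉ T ∧ y ≠ v) ⟨hoT, hov⟩ (fun f hf z hz => hf.2 z hz) hy
  have hLout : ∀ y, (openGraph ET).Reachable o y → y ∉ T := fun y hy =>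
    forall_reachable_of_edges (fun y => y ∉ T) hoT (fun f hf z hz => hf.2 z hz) hy
  -- in the complete support every vertex off `T` is joined to `o` avoiding `T`
  have hLall : ∀ y, y ∉ T → (openGraph ET).Reachable o y := by
    intro y hyT
    by_cases hoy : o = y
    · rw [hoy]
    · have hadj : (openGraph ET).Adj o y := by
        rw [openGraph, SimpleGraph.fromEdgeSet_adj]
        refine ⟨⟨Set.mem_univ _, fun z hz => ?_⟩, hoy⟩
        rcases Sym2.mem_iff.1 hz with rfl | rfl
        · exact hoT
        · exact hyT
      exact hadj.reachable
  rw [s5dMargin_nil_eq_zero_iff p E hE0 hE1 hconn o v b hov T hT r hr hcompat hoT hvT]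
  constructor
  · rintro (⟨hgate, _⟩ | ⟨a, haT, hgate, _, hbL⟩)
    · -- (M1) is impossible: a relay is adjacent to `o`
      exfalso
      obtain ⟨t, ht⟩ := hT
      rcases hgate o t (Set.mem_univ _) (SimpleGraph.Reachable.refl o) with h | h
      · exact (hKout t h).1 ht
      · exact hvT (h ▸ ht)
    · -- (M2): every relay is the gateway `a`, and `b = a`
      have hTa : ∀ t ∈ T, t = a := by
        intro t ht
        rcases hgate o t (Set.mem_univ _) (SimpleGraph.Reachable.refl o) with h | h
        · exact absurd ht (hLout t h)
        · exact h
      have hba : b = a := by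
        by_contra hba
        have hbT : b ∉ T := fun h => hba (hTa b h)
        exact hbL (hLall b hbT)
      ext t
      rw [Finset.mem_singleton]
      exact ⟨fun ht => (hTa t ht).trans hba.symm, fun ht => by rw [ht, hba]; exact haT⟩
  · intro hTb
    right
    have hbT : b ∈ T := by rw [hTb]; exact Finset.mem_singleton_self b
    refine ⟨b, hbT, fun p' q hpq hp' => ?_, ?_, fun h => (hLout b h) hbT⟩
    · by_cases hqT : q ∈ T
      · right; rw [hTb] at hqT; exact Finset.mem_singleton.1 hqT
      · exact Or.inl (hLall q hqT)
    · unfold rankGain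
      refine Finset.sum_eq_zero fun t ht => ?_
      obtain ⟨htT, hlt⟩ := Finset.mem_filter.1 ht
      rw [hTb, Finset.mem_singleton] at htT
      rw [htT] at hlt
      exact absurd hlt (lt_irrefl _)

/-- **(S5) is strict in the socket's regime unless `T = {b}`.**  Weights `0 < p e < 1` on every pair; `T ≠ ∅`, `T ≠ {b}`; `r` injective compatible with the means
of `1{b ∈ ·}`; `o ≠ v` off `T`.  Then `0 < s5dMargin p T r [] o v 1{b ∈ ·}`. [cite: KozmaNitzan2024, Conj. 4 (p. 32)] -/
theorem s5dMargin_nil_pos_of_nondegenerate_of_ne_singleton (p : Sym2 (Fin n) → unitInterval) (hp : ∀ e, 0 < p e ∧ p e < 1)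
    (o v b : Fin n) (hov : o ≠ v) (T : Finset (Fin n)) (hT : T.Nonempty) (hTb : T ≠ {b}) (r : Fin n → ℕ) (hr : Set.InjOn r ↑T)
    (hcompat : ∀ a ∈ T, ∀ a' ∈ T, r a < r a' →
      ∫ ω, (fun S : Set (Fin n) => if b ∈ S then (1 : ℝ) else 0) (openCluster ω a) ∂(prodBernoulli p) ≤
        ∫ ω, (fun S : Set (Fin n) => if b ∈ S then (1 : ℝ) else 0) (openCluster ω a') ∂(prodBernoulli p))
    (hoT : o ∉ T) (hvT : v ∉ T) :
    0 < s5dMargin p T r [] o v (fun S : Set (Fin n) => if b ∈ S then (1 : ℝ) else 0) := by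
  have hne : s5dMargin p T r [] o v (fun S : Set (Fin n) => if b ∈ S then (1 : ℝ) else 0) ≠ 0 := fun h =>
    hTb ((s5dMargin_nil_eq_zero_iff_eq_singleton_of_nondegenerate p hp o v b hov T hT r hr hcompat hoT hvT).1 h)
  -- the margin is nonnegative: it dominates the nonnegative rank-gain floor of row M2-R3
  have hw : ∀ e, 0 < p e ∧ p e < 1 := hp
  have hFmono : ∀ S S' : Set (Fin n), S ⊆ S' →
      (fun S : Set (Fin n) => if b ∈ S then (1 : ℝ) else 0) S ≤ (fun S : Set (Fin n) => if b ∈ S then (1 : ℝ) else 0) S' := by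
    intro S S' hSS'
    simp only
    by_cases hS : b ∈ S
    · rw [if_pos hS, if_pos (hSS' hS)]
    · rw [if_neg hS]; split_ifs <;> norm_num
  have hfloor := s5dMargin_ge_sum_rankGain p hw o v hov T r [] _ hFmono hr hcompat hoT hvT List.nodup_nil (fun d hd => by simp at hd)
  have hnn : 0 ≤ ∑ a ∈ T, rankGain p T r (fun S : Set (Fin n) => if b ∈ S then (1 : ℝ) else 0) a *
      avoidConst p a ((↑(T.erase a) : Set (Fin n)) ∪ ({d | d ∈ ([] : List (Fin n))} ∪ {v})) o := by
    refine Finset.sum_nonneg fun a ha => mul_nonneg (rankGain_nonneg p T r _ a fun a' ha' hlt => hcompat a' ha' a ha hlt) ?_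
    unfold avoidConst
    exact div_nonneg measureReal_nonneg measureReal_nonneg
  exact lt_of_le_of_ne (le_trans hnn hfloor) (Ne.symm hne)

end CSH

end Summit.CriticalPhenomena.PercolationContinuityZ3.Theorems
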